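import Summits.AtomisticToContinuum.Crystallization.Theses.DisclinationRation
import Summits.AtomisticToContinuum.Crystallization.Theorems.PhononStability.Negative.Mirror

/-!
# `UniformPolytypeStability` (stmt-AtomisticToContinuum-15800), line `birth` (v2, cells): VOCABULARY

Route `DisclinationRation`, crux `UniformPolytypeStability` (uniform harmonic stability of Lennard-Jones over all force-balanced
layered polytypes `L(a,s,z)` in the box `a ∈ [47/50,1]`, gaps in `[39a/50, 17a/20]`: `κ·nnForm ≤ hessForm/2`).
This file fixes the vocabulary of the line `birth` (crux workfile `Cruxes/UniformPolytypeStability/Lines/birth.lean`, lead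
prover-line-stmt-AtomisticToContinuum-15800-0) so that its stub lemmas, landed as separate `--supports` files, speak about
the same objects:

* the crux's inlined objects named (`Sites HeightBox ForceBalanced nnForm hessForm`, `uniformPolytypeStability_iff` is `Iff.rfl`);
* site indices `Idx = ℤ³`, `pos`, the combinatorial shells `InPlaneNN UpNN UpDiag NNPair DiagPair NearPair`, the pair terms
  `hessTerm nnTerm nearTerm farTerm nnTermC` over `Idx × Idx`;
* the parallelepiped CELLS of each slab (`CIdx`, `Corner`, `cvert`, `bondTable`, `cellHess`, `cellNN`), their six
  sub-tetrahedra (`subTetTable`, `gap`, `dualVec`, `gradVec`, `subTetGrad`, `subTetVol`) and the discrete null Lagrangians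
  `nullMinor`, `cellNull`;
* the predicates of the line's STUB STATEMENTS registered on the crux item (`SitesFacts`, `PairSumFacts`, `NearCellFacts`,
  `NullFactsAt`, `GapsPinned`, `FarNearAt`), each stub to be proved by a `--supports` file of the line as
  `theorem stub_<name> : ∀ a s z, <box> → …`; the sorry-free composition to the crux lives in the crux workfile and
  lands last.

These are line-internal bookkeeping definitions and proof obligations of THIS line (targets, not literature facts and not
assumptions of any landed theorem); everything is `[folklore]`; nothing here closes an item.  `stub_defs` is the registered anchor.
-/

noncomputable section

namespace Summit.AtomisticToContinuum.Crystallization.Theorems.UniformPolytypeStabilityCells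

open scoped BigOperators Topology Classical InnerProductSpace
open Filter Set Function
open Literature.MathematicalPhysics.StatisticalMechanics
open Summit.AtomisticToContinuum.Crystallization.Theorems.PhononStabilityNegative (Hess₀)

/-- Euclidean `3`-space. [folklore] -/
local notation "E3" => EuclideanSpace ℝ (Fin 3)

/-! ### The inlined objects of the crux, named (all unfold definitionally to the crux text) -/

/-- The layered site set `L(a,s,z)`: triangular layers of spacing `a`, layer `m` in hole
registry `haggLabel s m`, at height `z m` (verbatim the crux's `let Sites`). [folklore] -/
def Sites (a : ℝ) (s : ℤ → ℤ) (z : ℤ → ℝ) : Set E3 :=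
  {p | ∃ m i j : ℤ, p = ((i : ℝ) • triangularVec₁ a) + ((j : ℝ) • triangularVec₂ a) +
    ((haggLabel s m : ℝ) • barlowOffset a) + (z m • layerNormal 1)}

/-- The height box: interlayer increments in `[39a/50, 17a/20]` (verbatim the crux's hypothesis). [folklore] -/
def HeightBox (a : ℝ) (z : ℤ → ℝ) : Prop :=
  ∀ m : ℤ, 39 / 50 * a ≤ z (m + 1) - z m ∧ z (m + 1) - z m ≤ 17 / 20 * a

/-- Exact Lennard-Jones force balance of `L(a,s,z)` (verbatim the crux's hypothesis). [folklore] -/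
def ForceBalanced (a : ℝ) (s : ℤ → ℤ) (z : ℤ → ℝ) : Prop :=
  ∀ p ∈ Sites a s z, HasSum (fun q : {q : E3 // q ∈ Sites a s z ∧ q ≠ p} =>
    (deriv lennardJones (dist p q.1) / dist p q.1) • (p - q.1)) 0

/-- Nearest-neighbour strain form `N(u) = Σ_{|p−q| ≤ 11/10} ‖u_p − u_q‖²` (verbatim the crux's
left-hand double `tsum`). [folklore] -/
def nnForm (a : ℝ) (s : ℤ → ℤ) (z : ℤ → ℝ) (u : E3 → E3) : ℝ :=
  ∑' p : Sites a s z, ∑' q : Sites a s z, if dist (p : E3) q ≤ 11 / 10 then ‖u p - u q‖ ^ 2 else 0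

/-- Full second variation `H(u) = Σ_{p ≠ q} (u_p−u_q)ᵀ K(p−q) (u_p−u_q)` (verbatim the crux's
right-hand double `tsum`, before halving; `Hess₀` is the crux's `let Hess`). [folklore] -/
def hessForm (a : ℝ) (s : ℤ → ℤ) (z : ℤ → ℝ) (u : E3 → E3) : ℝ :=
  ∑' p : Sites a s z, ∑' q : Sites a s z,
    if (p : E3) ≠ q then Hess₀ ((p : E3) - q) (u p - u q) else 0

/-- The crux over the named objects (definitional unfolding only; the form provers `rw` into). [folklore] -/
theorem uniformPolytypeStability_iff :
    Summit.AtomisticToContinuum.Crystallization.Theses.DisclinationRation.UniformPolytypeStability ↔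
      ∃ κ : ℝ, 0 < κ ∧ ∀ (a : ℝ) (s : ℤ → ℤ) (z : ℤ → ℝ), 47 / 50 ≤ a → a ≤ 1 → IsHaggSeq s →
        HeightBox a z → ForceBalanced a s z →
        ∀ u : E3 → E3, (Function.support u).Finite → Function.support u ⊆ Sites a s z →
          κ * nnForm a s z u ≤ hessForm a s z u / 2 :=
  Iff.rfl

/-! ### Site indices and the combinatorial shells -/

/-- Site indices `(m, i, j)`: layer `m`, in-layer lattice coordinates `(i, j)`. [folklore] -/
abbrev Idx := ℤ × ℤ × ℤ

/-- The site with index `(m,i,j)`: `i•v₁ + j•v₂ + (haggLabel s m)•w + z m • e₃`. [folklore] -/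
def pos (a : ℝ) (s : ℤ → ℤ) (z : ℤ → ℝ) (x : Idx) : E3 :=
  ((x.2.1 : ℝ) • triangularVec₁ a) + ((x.2.2 : ℝ) • triangularVec₂ a) +
    ((haggLabel s x.1 : ℝ) • barlowOffset a) + (z x.1 • layerNormal 1)

/-- In-layer nearest-neighbour offsets `±(1,0), ±(0,1), ±(1,−1)` (the six vectors of length `a`). [folklore] -/
def InPlaneNN (d : ℤ × ℤ) : Prop :=
  d = (1, 0) ∨ d = (-1, 0) ∨ d = (0, 1) ∨ d = (0, -1) ∨ d = (1, -1) ∨ d = (-1, 1)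

/-- Interlayer nearest-neighbour in-plane offsets from layer `m` to layer `m+1` when the letter is `σ = s m`:
`(0,0), (−σ,0), (0,−σ)` (the three vectors `d + σw` of length `a/√3`). [folklore] -/
def UpNN (σ : ℤ) (d : ℤ × ℤ) : Prop :=
  d = (0, 0) ∨ d = (-σ, 0) ∨ d = (0, -σ)

/-- Octahedron-diagonal in-plane offsets from layer `m` to layer `m+1` when the letter is `σ`:
`(−σ,−σ), (1,−1), (−1,1)` (the three vectors `d + σw` of length `2a/√3`). [folklore] -/
def UpDiag (σ : ℤ) (d : ℤ × ℤ) : Prop :=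
  d = (-σ, -σ) ∨ d = (1, -1) ∨ d = (-1, 1)

/-- `NNPair s x y`: the sites `x ≠ y` are nearest neighbours (the 12-shell; `= (0 < dist ≤ 11/10)` on the box). [folklore] -/
def NNPair (s : ℤ → ℤ) (x y : Idx) : Prop :=
  (y.1 = x.1 ∧ InPlaneNN (y.2.1 - x.2.1, y.2.2 - x.2.2)) ∨
    (y.1 = x.1 + 1 ∧ UpNN (s x.1) (y.2.1 - x.2.1, y.2.2 - x.2.2)) ∨
    (x.1 = y.1 + 1 ∧ UpNN (s y.1) (x.2.1 - y.2.1, x.2.2 - y.2.2))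

/-- `DiagPair s x y`: the sites are the two ends of an octahedron diagonal between adjacent layers
(`= (11/10 < dist ≤ 29/20)` on the box). [folklore] -/
def DiagPair (s : ℤ → ℤ) (x y : Idx) : Prop :=
  (y.1 = x.1 + 1 ∧ UpDiag (s x.1) (y.2.1 - x.2.1, y.2.2 - x.2.2)) ∨
    (x.1 = y.1 + 1 ∧ UpDiag (s y.1) (x.2.1 - y.2.1, x.2.2 - y.2.2))

/-- `NearPair = NNPair ∨ DiagPair` (`= (0 < dist ≤ 29/20)` on the box): exactly the bonds of the cells. [folklore] -/
def NearPair (s : ℤ → ℤ) (x y : Idx) : Prop := NNPair s x y ∨ DiagPair s x y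

/-! ### Pair terms over indices -/

/-- The second-variation pair term `(U x − U y)ᵀ K(pos x − pos y) (U x − U y)` for `x ≠ y` (else `0`). [folklore] -/
def hessTerm (a : ℝ) (s : ℤ → ℤ) (z : ℤ → ℝ) (U : Idx → E3) (xy : Idx × Idx) : ℝ :=
  if xy.1 ≠ xy.2 then Hess₀ (pos a s z xy.1 - pos a s z xy.2) (U xy.1 - U xy.2) else 0

/-- The nearest-neighbour pair term `‖U x − U y‖²` for `dist ≤ 11/10` (metric form, as in the crux). [folklore] -/
def nnTerm (a : ℝ) (s : ℤ → ℤ) (z : ℤ → ℝ) (U : Idx → E3) (xy : Idx × Idx) : ℝ :=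
  if dist (pos a s z xy.1) (pos a s z xy.2) ≤ 11 / 10 then ‖U xy.1 - U xy.2‖ ^ 2 else 0

/-- The near part of the pair term (cell bonds). [folklore] -/
def nearTerm (a : ℝ) (s : ℤ → ℤ) (z : ℤ → ℝ) (U : Idx → E3) (xy : Idx × Idx) : ℝ :=
  if NearPair s xy.1 xy.2 then Hess₀ (pos a s z xy.1 - pos a s z xy.2) (U xy.1 - U xy.2) else 0

/-- The far part of the pair term (`x ≠ y`, not a cell bond). [folklore] -/
def farTerm (a : ℝ) (s : ℤ → ℤ) (z : ℤ → ℝ) (U : Idx → E3) (xy : Idx × Idx) : ℝ :=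
  if xy.1 ≠ xy.2 ∧ ¬ NearPair s xy.1 xy.2 then Hess₀ (pos a s z xy.1 - pos a s z xy.2) (U xy.1 - U xy.2) else 0

/-- The combinatorial nearest-neighbour term `‖U x − U y‖²` for `NNPair`. [folklore] -/
def nnTermC (s : ℤ → ℤ) (U : Idx → E3) (xy : Idx × Idx) : ℝ :=
  if NNPair s xy.1 xy.2 then ‖U xy.1 - U xy.2‖ ^ 2 else 0

/-! ### Cells (parallelepipeds per slab), their bonds and sub-tetrahedra -/

/-- Cell indices `(k, n₁, n₂)`: slab `k` (between layers `k` and `k+1`), in-plane cube position `(n₁, n₂)`. [folklore] -/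
abbrev CIdx := ℤ × ℤ × ℤ

/-- Corners of the unit cube `(x, y, z) ∈ {0,1}³`. [folklore] -/
abbrev Corner := Fin 2 × Fin 2 × Fin 2

/-- The site at corner `c` of cell `ι`: layer `k + c.z`, in-plane index `n + σ·(c.x, c.y)` with `σ = s k`
(for `σ = −1` the labelling is rotated by `π` about the vertical, which makes `bondTable` letter-independent). [folklore] -/
def cvert (s : ℤ → ℤ) (ι : CIdx) (c : Corner) : Idx :=
  (ι.1 + (c.2.2 : ℕ), ι.2.1 + s ι.1 * (c.1 : ℕ), ι.2.2 + s ι.1 * (c.2.1 : ℕ))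

/-- Corner constructor from bits. [folklore] -/
def mkC (x y w : Fin 2) : Corner := (x, y, w)

/-- The 21 bonds of a cell: `(corner, corner, share, isNN)`; 10 in-plane nearest-neighbour bonds (rhombus sides
share `1/4`, short diagonals share `1/2`), 8 interlayer nearest-neighbour bonds (vertical cell edges share `1/4`,
slant face diagonals share `1/2`), 3 octahedron diagonals (share `1`).  Share = 1/(number of cells containing the bond). [folklore] -/
def bondTable : List (Corner × Corner × ℚ × Bool) :=
  [ -- bottom face (w = 0)
    (mkC 0 0 0, mkC 1 0 0, 1/4, true), (mkC 0 0 0, mkC 0 1 0, 1/4, true),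
    (mkC 1 0 0, mkC 1 1 0, 1/4, true), (mkC 0 1 0, mkC 1 1 0, 1/4, true),
    (mkC 1 0 0, mkC 0 1 0, 1/2, true),
    -- top face (w = 1)
    (mkC 0 0 1, mkC 1 0 1, 1/4, true), (mkC 0 0 1, mkC 0 1 1, 1/4, true),
    (mkC 1 0 1, mkC 1 1 1, 1/4, true), (mkC 0 1 1, mkC 1 1 1, 1/4, true),
    (mkC 1 0 1, mkC 0 1 1, 1/2, true),
    -- vertical edges
    (mkC 0 0 0, mkC 0 0 1, 1/4, true), (mkC 1 0 0, mkC 1 0 1, 1/4, true),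
    (mkC 0 1 0, mkC 0 1 1, 1/4, true), (mkC 1 1 0, mkC 1 1 1, 1/4, true),
    -- slant face diagonals (in-plane offset (−1,0) and (0,−1) upward)
    (mkC 1 0 0, mkC 0 0 1, 1/2, true), (mkC 1 1 0, mkC 0 1 1, 1/2, true),
    (mkC 0 1 0, mkC 0 0 1, 1/2, true), (mkC 1 1 0, mkC 1 0 1, 1/2, true),
    -- octahedron diagonals (in-plane offsets (−1,−1), (1,−1), (−1,1) upward)
    (mkC 1 1 0, mkC 0 0 1, 1, false), (mkC 0 1 0, mkC 1 0 1, 1, false), (mkC 1 0 0, mkC 0 1 1, 1, false) ]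

/-- The cell's share of the near second variation: `Σ_bonds share · (ΔU)ᵀ K(Δpos) (ΔU)`. [folklore] -/
def cellHess (a : ℝ) (s : ℤ → ℤ) (z : ℤ → ℝ) (U : Idx → E3) (ι : CIdx) : ℝ :=
  (bondTable.map fun b =>
    (b.2.2.1 : ℝ) * Hess₀ (pos a s z (cvert s ι b.1) - pos a s z (cvert s ι b.2.1))
      (U (cvert s ι b.1) - U (cvert s ι b.2.1))).sum

/-- The cell's share of the nearest-neighbour form: `Σ_{NN bonds} share · ‖ΔU‖²`. [folklore] -/
def cellNN (s : ℤ → ℤ) (U : Idx → E3) (ι : CIdx) : ℝ :=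
  (bondTable.map fun b =>
    if b.2.2.2 then (b.2.2.1 : ℝ) * ‖U (cvert s ι b.1) - U (cvert s ι b.2.1)‖ ^ 2 else 0).sum

/-- The 6 sub-tetrahedra of the unit cube (corner tetrahedra at `000` and `111`, four around the octahedron
diagonal `110–001`), each vertex with the gradient of its barycentric coordinate in cube coordinates. [folklore] -/
def subTetTable : List (List (Corner × ℤ × ℤ × ℤ)) :=
  [ [(mkC 0 0 0, -1, -1, -1), (mkC 1 0 0, 1, 0, 0), (mkC 0 1 0, 0, 1, 0), (mkC 0 0 1, 0, 0, 1)],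
    [(mkC 1 1 1, 1, 1, 1), (mkC 0 1 1, -1, 0, 0), (mkC 1 0 1, 0, -1, 0), (mkC 1 1 0, 0, 0, -1)],
    [(mkC 1 1 0, 0, 1, 0), (mkC 0 0 1, -1, 0, 0), (mkC 1 0 0, 0, -1, -1), (mkC 1 0 1, 1, 0, 1)],
    [(mkC 1 1 0, 0, 0, -1), (mkC 0 0 1, -1, -1, -1), (mkC 1 0 1, 1, 0, 1), (mkC 0 1 1, 0, 1, 1)],
    [(mkC 1 1 0, 1, 0, 0), (mkC 0 0 1, 0, -1, 0), (mkC 0 1 1, 0, 1, 1), (mkC 0 1 0, -1, 0, -1)],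
    [(mkC 1 1 0, 1, 1, 1), (mkC 0 0 1, 0, 0, 1), (mkC 0 1 0, -1, 0, -1), (mkC 1 0 0, 0, -1, -1)] ]

/-- The gap of slab `k`: `h_k = z (k+1) − z k`. [folklore] -/
def gap (z : ℤ → ℝ) (k : ℤ) : ℝ := z (k + 1) - z k

/-- Dual frame of the cell frame `(σ v₁, σ v₂, σ w + h e₃)`:
`b¹ = (σ/a, −σ/(a√3), −1/(3h))`, `b² = (0, 2σ/(a√3), −1/(3h))`, `b³ = (0, 0, 1/h)`. [folklore] -/
def dualVec (a : ℝ) (s : ℤ → ℤ) (z : ℤ → ℝ) (k : ℤ) (j : Fin 3) : E3 :=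
  ![!₂[(s k : ℝ) / a, -(s k : ℝ) / (a * Real.sqrt 3), -1 / (3 * gap z k)],
    !₂[0, 2 * (s k : ℝ) / (a * Real.sqrt 3), -1 / (3 * gap z k)],
    !₂[0, 0, 1 / gap z k]] j

/-- The gradient `∇λ_v = Σ_j ĝ_j b^j` of the barycentric coordinate of a sub-tetrahedron vertex with cube-coordinate
gradient `ĝ = (g₁, g₂, g₃)`. [folklore] -/
def gradVec (a : ℝ) (s : ℤ → ℤ) (z : ℤ → ℝ) (k : ℤ) (g : ℤ × ℤ × ℤ) : E3 :=
  (g.1 : ℝ) • dualVec a s z k 0 + (g.2.1 : ℝ) • dualVec a s z k 1 + (g.2.2 : ℝ) • dualVec a s z k 2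

/-- The affine displacement gradient `F_T = Σ_{v ∈ T} U_v ⊗ ∇λ_v` of a sub-tetrahedron, as a `3 × 3` matrix. [folklore] -/
def subTetGrad (a : ℝ) (s : ℤ → ℤ) (z : ℤ → ℝ) (U : Idx → E3) (ι : CIdx) (T : List (Corner × ℤ × ℤ × ℤ)) :
    Matrix (Fin 3) (Fin 3) ℝ :=
  (T.map fun vg => Matrix.vecMulVec (fun i => U (cvert s ι vg.1) i) (fun j => gradVec a s z ι.1 vg.2 j)).sum

/-- The quadratic null Lagrangian with coefficient tensor `C`: `N_C(F) = Σ_{p,q} C p q (F_{p₁q₁}F_{p₂q₂} − F_{p₁q₂}F_{p₂q₁})`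
(a combination of `2 × 2` minors of `F`; `C = δ_{p₁p₂... }` gives `σ₂(F)`). [folklore] -/
def nullMinor (C : Fin 3 × Fin 3 → Fin 3 × Fin 3 → ℝ) (F : Matrix (Fin 3) (Fin 3) ℝ) : ℝ :=
  ∑ p : Fin 3 × Fin 3, ∑ q : Fin 3 × Fin 3, C p q * (F p.1 q.1 * F p.2 q.2 - F p.1 q.2 * F p.2 q.1)

/-- The common volume `a² √3 h_k / 12` of the six sub-tetrahedra of a cell of slab `k`. [folklore] -/
def subTetVol (a : ℝ) (z : ℤ → ℝ) (k : ℤ) : ℝ := a ^ 2 * Real.sqrt 3 * gap z k / 12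

/-- The cell's null-Lagrangian term `Σ_T vol_T · N_C(F_T)`. [folklore] -/
def cellNull (C : Fin 3 × Fin 3 → Fin 3 × Fin 3 → ℝ) (a : ℝ) (s : ℤ → ℤ) (z : ℤ → ℝ) (U : Idx → E3)
    (ι : CIdx) : ℝ :=
  (subTetTable.map fun T => subTetVol a z ι.1 * nullMinor C (subTetGrad a s z U ι T)).sum

/-! ### The stub statements, named -/

/-- `SitesFacts a s z`: the index picture of `Sites a s z` on the box. [folklore] -/
def SitesFacts (a : ℝ) (s : ℤ → ℤ) (z : ℤ → ℝ) : Prop :=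
  Function.Injective (pos a s z) ∧ Set.range (pos a s z) = Sites a s z ∧
    (∀ x y : Idx, x ≠ y → 9 / 10 ≤ dist (pos a s z x) (pos a s z y)) ∧
    (∀ x y : Idx, (x ≠ y ∧ dist (pos a s z x) (pos a s z y) ≤ 11 / 10) ↔ NNPair s x y) ∧
    (∀ x y : Idx, (x ≠ y ∧ dist (pos a s z x) (pos a s z y) ≤ 29 / 20) ↔ NearPair s x y)

/-- `PairSumFacts a s z`: the crux's double `tsum`s are absolutely convergent pair sums over `Idx × Idx`. [folklore] -/
def PairSumFacts (a : ℝ) (s : ℤ → ℤ) (z : ℤ → ℝ) : Prop :=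
  ∀ u : E3 → E3, (Function.support u).Finite → Function.support u ⊆ Sites a s z →
    Summable (hessTerm a s z (u ∘ pos a s z)) ∧
      hessForm a s z u = ∑' xy : Idx × Idx, hessTerm a s z (u ∘ pos a s z) xy ∧
      Summable (nnTerm a s z (u ∘ pos a s z)) ∧
      nnForm a s z u = ∑' xy : Idx × Idx, nnTerm a s z (u ∘ pos a s z) xy

/-- `NearCellFacts a s z`: near pair sums regroup into cell sums (finitely supported in the cell index). [folklore] -/
def NearCellFacts (a : ℝ) (s : ℤ → ℤ) (z : ℤ → ℝ) : Prop :=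
  ∀ U : Idx → E3, (Function.support U).Finite →
    (Function.support (cellHess a s z U)).Finite ∧ (Function.support (cellNN s U)).Finite ∧
      Summable (nearTerm a s z U) ∧ Summable (nnTermC s U) ∧
      ∑' xy : Idx × Idx, nearTerm a s z U xy = 2 * ∑' ι : CIdx, cellHess a s z U ι ∧
      ∑' xy : Idx × Idx, nnTermC s U xy = 2 * ∑' ι : CIdx, cellNN s U ι

/-- `NullFactsAt a s z`: the cell null Lagrangians of a finitely supported displacement sum to zero. [folklore] -/
def NullFactsAt (a : ℝ) (s : ℤ → ℤ) (z : ℤ → ℝ) : Prop :=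
  ∀ (C : Fin 3 × Fin 3 → Fin 3 × Fin 3 → ℝ) (U : Idx → E3), (Function.support U).Finite →
    (Function.support (cellNull C a s z U)).Finite ∧ ∑' ι : CIdx, cellNull C a s z U ι = 0

/-- `GapsPinned z`: all interlayer gaps lie within `1/500` of each other. [folklore] -/
def GapsPinned (z : ℤ → ℝ) : Prop := ∀ m m' : ℤ, |gap z m - gap z m'| ≤ 1 / 500

/-- `FarNearAt κ₁`: the load-bearing inequality over indices, on pinned configurations of the box:
`κ₁ · 2Σ_cells cellNN ≤ ½ (2Σ_cells cellHess + Σ_{far pairs} (ΔU)ᵀK(ΔU))` for every finitely supported `U`. [folklore] -/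
def FarNearAt (κ₁ : ℝ) : Prop :=
  ∀ (a : ℝ) (s : ℤ → ℤ) (z : ℤ → ℝ), 47 / 50 ≤ a → a ≤ 1 → IsHaggSeq s → HeightBox a z →
    GapsPinned z → SitesFacts a s z → ∀ U : Idx → E3, (Function.support U).Finite →
      Summable (hessTerm a s z U) →
        κ₁ * (2 * ∑' ι : CIdx, cellNN s U ι) ≤
          (2 * ∑' ι : CIdx, cellHess a s z U ι + ∑' xy : Idx × Idx, farTerm a s z U xy) / 2

/-! ## Anchor -/

/-- Registered anchor sub-goal of the line (`stub_defs`): units sanity of the cell tables (21 bonds, 6 sub-tetrahedra);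
its landing puts this vocabulary in the tree. [folklore] -/
theorem stub_defs : bondTable.length = 21 ∧ subTetTable.length = 6 := by
  constructor <;> rfl

end Summit.AtomisticToContinuum.Crystallization.Theorems.UniformPolytypeStabilityCells

end
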